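import Mathlib
import HarnessLib
import HarnessLib.Audit
import Summits.AtomisticToContinuum.Statement
import Literature.MathematicalPhysics.QuantumManyBody.PeriodicBoseGas

/-!
Route: BECWallDressing

CLOSED (retired) 2026-08-15T13:41:06Z by operator:999:1257524 — reason: not-a-thesis: assembly does not conclude the sub-problem Statement — note: D-0027 §2.1 audit (human 2026-08-15: routes that do not decide the summit are removed): the assembly concludes `Literature.MathematicalPhysics.QuantumManyBody.BoseGas.BoseEinsteinCondensation`, not the sub-problem statement; a NEW conforming route may be opened from the same idea (generated `closes . The file is kept as the record of this route; refuted decls are indexed as negative knowledge (`ledger negatives`).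

# Route BECWallDressing — wall dressing: Psi_Dir/(Psi_torus x prod of one-body wall profiles) has
N-uniform one-particle oscillation, so torus landscape condensation transfers to the Dirichlet box
in one explicit mode

It suffices to show X = WallDressing ∧ TorusLandscapeDirichletTypical ∧ GroundStatePair (+ the
routine WallLayerMass).
Realises card wall-dressing-transfer (spine; grafts from its retired duplicate
doob-wall-dressing-transfer: exact Doob statement,
boundary Harnack in the tagged variable, typical-set assembly). All statements are typed over an
INLINED ground-state interface
(no new definitions): Ψ₀ ≥ 0 continuous, vanishing off the box, and the L²-limit up to phase of ALL
δ-near-minimisers of the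
Dirichlet energy (δ → 0); Φ₀ likewise for the torus (PeriodicTrialState, cellN) — uniqueness is
thereby an explicit crux
(GroundStatePair), never smuggled. With N+1 particles, (x :: Y) = Matrix.vecCons x Y, L = sideLength
ρ (N+1), and
w_D(Y) = ∫Ψ₀(x::Y)² dx the Dirichlet law of the environment Y:
(W) WallDressing — for w_D-all-but-η environments Y, the ratio Ψ₀(x::Y)/(Φ₀(x::Y)·s(x)), s(z) = ∏_k
min(1, z_k/ℓ, (L−z_k)/ℓ)
a product one-body wall profile (some ℓ ∈ (0, εL]), oscillates over x ∈ Λ_b = (b, L−b)³ by at most a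
factor C(ε, η)
UNIFORM IN N (two-sided, m(Y)-free ratio form; b ≥ range(v) removes periodic-image zeros of Φ₀);
(T) TorusLandscapeDirichletTypical — for w_D-all-but-η environments the TORUS conditional amplitude
x ↦ Φ₀(x::Y) is
delocalised on every inner cube Λ'_ε, ε ∈ [0, 1/4): (∫_Λ' Φ₀)² ≥ c·|Λ'|·∫_Λ' Φ₀², c = c(ε, η)
uniform in N
(the torus input in the Dirichlet-typical form this transfer consumes = card items W2 + PL jointly);
(G) GroundStatePair — both interfaces are inhabited for all large N at small ρ (existence,
uniqueness up to phase,
positivity, continuity of the two ground states).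
Then InnerCondensation (target: ≥ c(N+1) bosons of Ψ₀ in the flat mode of an inner cube) and the
conjunct follow by
measure theory (LandscapeTransfer, TargetToBEC).
Lean: `WallDressing ∧ TorusLandscapeDirichletTypical ∧ GroundStatePair ∧ WallLayerMass`

## Assembly
LandscapeTransfer turns the three cruxes (+ WallLayerMass) into InnerCondensation by the angle
algebra above (pure measure theory:
Fubini over (x :: Y), Cauchy–Schwarz, the three typicality budgets); TargetToBEC turns
InnerCondensation + GroundStatePair into the
conjunct via occupation_le_maxOccupation / le_condensateNumber (the bec_of_zeroMode pattern with the
inner flat mode). The Assembly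
is their composition (term-mode, checked in Sketch.lean: `fun a b c d => h2 (h1 a b d c) c`).

Rationale: WHY THIS LINE. The audited conjunct is DIRICHLET while every engine (Fournais2020, Junge2026,
ChongLiangNam2026, the positivity cards) works on the
torus; route BECPeriodicReduction isolated the transfer as crux BoundaryTransferWeak
(stmt-AtomisticToContinuum-0827) but has no
mechanism for it — energies cannot do it (wall term ≫ any usable slack,
LiebSeiringerSolovejYngvason2005 Ch. 2 gives the ENERGY only).
Positivity gives one: Φ := Ψ_Dir/Ψ_torus is the principal eigenfunction of the torus ground-state
diffusion killed at the
faces (a many-body Doob h-transform, eigenvalue E_D − E_P), and the thesis is that Φ is PRODUCT-LIKE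
in each tagged variable up
to bounded distortion — a boundary Harnack / intrinsic-ultracontractivity comparison
(BassBurdzy1991, DaviesSimon1984, Pinsky1995) whose whole
difficulty is uniformity of the constants in the dimension 3N, and whose one-body factor is the
Gross–Pitaevskii healing profile
(LiebSeiringer2002, LiebSeiringerSolovejYngvason2005 Ch. 6–7, Margetis2000). Imported areas:
potential theory of positive harmonic
functions / h-transforms (probability–PDE) and GP boundary-layer theory; the information/landscape
criterion of the positivity
cards supplies the currency (occupation of one explicit mode ≥ e^(−O(1))·N, so O(1) losses are
free). What it does that prior
routes do not: a typed, mode-explicit mechanism for the Dirichlet step with no inner-box infrared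
bound, no shell-mass item at
scale εL and no energy comparison; the negatives index is empty (2026-08-15).

RANKED CRUXES. #0 InnerCondensation (target) — for every repulsive finite-range v, small ρ, some c >
0 and ε ∈ (0,1/4), for all large N and every Dirichlet ground state Ψ₀ of N+1 bosons in the box of
side L = sideLength ρ (N+1) (inlined interface), the flat normalised mode of the inner cube Λ'_ε =
(εL, L−εL)³ has occupation ≥ c(N+1) in Ψ₀. (why it might fail: it is Dirichlet-box BEC itself in
landscape-free form; fails only if the conjunct fails or the ground state is degenerate (interface
empty ⇒ vacuous, then TargetToBEC has nothing to feed).) [LiebSeiringerSolovejYngvason2005,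
Junge2026, ChongLiangNam2026]
#2 WallDressing (crux) — (card W1, boundary-Harnack form) for every repulsive finite-range v there
is b > 0 (≥ its range) such that at all small ρ, for every ε > 0 and η > 0 there is C with: for all
large N there is ℓ ∈ (0, εL] such that for the Dirichlet ground state Ψ₀ and the torus ground state
Φ₀ of N+1 bosons (side L = sideLength ρ (N+1), inlined interfaces) the set of environments Y for
which C·Ψ₀(y::Y)Φ₀(x::Y)s(x) < Ψ₀(x::Y)Φ₀(y::Y)s(y) for some x, y ∈ Λ_b (i.e. the one-particle
oscillation of Ψ₀/(Φ₀·s) over Λ_b exceeds C; s(z) = ∏_k min(1, z_k/ℓ, (L−z_k)/ℓ)) has w_D-mass ≤ η.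
Free gas: holds with ℓ = εL, C = sin(πε)⁻³ (Ψ₀ = ∏ sin, Φ₀ = const). [difficulty: XL] (why it might
fail: Φ=Ψ_D/Ψ_P is harmonic for the FULL 3(N+1)-dim ground-state diffusion, not in x alone:
Harnack/IU constants grow with dimension (DaviesSimon1984) unless curvature is available (Wang2012);
an L²-Poincaré loss or an unscreened phonon tail would give osc ~ log L or worse.) [DaviesSimon1984,
BassBurdzy1991, Pinsky1995, Wang2012, LiebSeiringer2002, LiebSeiringerSolovejYngvason2005,
Margetis2000]
#3 TorusLandscapeDirichletTypical (crux) — (card W2 + PL jointly, typical-set form) for every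
repulsive finite-range v, small ρ, every ε ∈ [0,1/4) and η > 0 there is c > 0 with: for all large N,
for the Dirichlet/torus ground-state pair (Ψ₀, Φ₀) of N+1 bosons, the set of environments Y whose
TORUS conditional amplitude x ↦ Φ₀(x::Y) fails (∫_Λ'ε Φ₀)² ≥ c·|Λ'ε|·∫_Λ'ε Φ₀² on the inner cube
Λ'_ε of the box has w_D-mass ≤ η — delocalisation of the torus landscape, but measured under the
DIRICHLET law of the environment. [difficulty: XL] (why it might fail: Dirichlet-typical Y (depleted
wall layer, N^(2/3) displaced bosons) are torus-atypical at large-deviation scale; torus engines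
give π_P-averages (0826) only; needs self-averaging of cos²∠(1,Φ₀(·::Y)) plus stability under wall
conditioning. False in d=1.) [LiebSeiringerSolovejYngvason2005, Fournais2020, Junge2026,
ChongLiangNam2026, Literature.Barriers.AtomisticToContinuum.PitaevskiiStringariOneDimension]
#4 GroundStatePair (crux) — for every repulsive finite-range v, all small ρ and all large N, both
inlined interfaces are inhabited at side L = sideLength ρ (N+1): there is a continuous Ψ₀ ≥ 0
vanishing off the box such that for every η > 0 some δ > 0 makes every δ-near-minimiser of the
Dirichlet energy L²-within η of e^(iθ)Ψ₀ for some θ, and a continuous periodic Φ₀ ≥ 0 with the same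
property for the torus energy on the cell (existence + uniqueness up to phase + positivity +
continuity of the two ground states; compact resolvent, Perron–Frobenius / positivity-improving
semigroup, elliptic regularity; E₀ < ⊤ via a lattice permanent trial state at ρ < c·range⁻³).
[difficulty: L] (why it might fail: IsRepulsiveFiniteRange admits hard shells (v = ⊤ on an annulus)
and non-Kato finite singularities: configuration space may disconnect (hard-core connectivity in a
box is itself open at moderate density) ⇒ degenerate ground space ⇒ no common L²-limit.)
[LiebSeiringerSolovejYngvason2005, DaviesSimon1984, Pinsky1995]
#9 WallLayerMass (support) — for every repulsive finite-range v and every b > 0, at all small ρ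
(depending on b) and all large N, the Dirichlet ground state Ψ₀ (interface) gives probability ≤ 1/8
to particle 0 lying within b of a face. Proof sketch: 1-D Hardy ∫u'² ≥ ¼∫u²/t² per face ⇒ P(layer) ≤
8b²·(kinetic energy per particle) for C¹ near-minimisers; E₀(N+1, L) ≤ C(N+1)ρ^(2/3) by the
symmetrised product of disjoint bumps on a lattice of spacing ~ρ^(−1/3) > 4·range (no interaction);
pass to the L²-limit Ψ₀. [difficulty: provable-now] [LiebSeiringerSolovejYngvason2005]
#9 LandscapeTransfer (support) — WallDressing → TorusLandscapeDirichletTypical → WallLayerMass →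
GroundStatePair → InnerCondensation. Angle algebra at η = 1/8: c₀ = c(ε=0), choose ε₁ < c₀/24, C =
C(ε₁), c₁ = c(ε₁); for Good Y (outside the three bad sets) on Λ_b one has Ψ₀ = r·s·Φ₀ with sup r ≤ C
inf r, whence (∫_Λ'ψ)² ≥ (c₁/C²)|Λ'|∫_Λ'ψ² and ∫_Λ'ψ² ≥ (c₀/4C²)∫_Λb ψ²; integrating in Y with
Fubini (piFinSuccAbove) and the layer bound: occupation/(N+1) ≥ (c₀c₁/4C⁴)(1 − 1/8 − 3/8) =
c₀c₁/(8C⁴); the torus ground state enters only to instantiate the two cruxes (GroundStatePair).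
[difficulty: M] [LiebSeiringerSolovejYngvason2005]
#9 TargetToBEC (support) — InnerCondensation → GroundStatePair → BoseEinsteinCondensation. The inner
flat mode is measurable and L²-normalised (pattern of Theorems/BECInfraredBoundAssembly:
lintegral_constMode_sq, bec_of_zeroMode); occupation^(1/2)/√(N+1) is a 1-Lipschitz seminorm in L²
and phase-blind, so the interface's near-minimiser clause with η ≤ c/4 gives occupation ≥ (c/4)(N+1)
for every δ-near-minimiser; le_condensateNumber and occupation_le_maxOccupation give
HasGroundStateBEC v ρ with constant c/4 (index shift N ↦ N+1 under ∀ᶠ). [difficulty: provable-now]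
[LiebSeiringerSolovejYngvason2005]

TWO-LAYER PLAN. Foreseen glued splits (none filed now): WallDressing ⇐ InteriorRatioHarnack
(oscillation of Ψ₀/Φ₀ over the inner cube only, s-free)
→ LayerComparison (Carleson/Hopf comparability Ψ₀ ≍ s·Φ₀·m on b < dist < εL) → WallDressing.
TorusLandscapeDirichletTypical ⇐
TorusLandscapeTypical (same event, failure mass ≤ η under the TORUS law: the deliverable of
PeriodicBEC-type engines by Markov from an
averaged participation bound) → WallConditioningStability (π_P-typical ⇒ π_D-typical for this bulk
event) → TLDT; alternative child:
a sup-form over a coarse-density class of environments + a large-deviation bound for that class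
under w_D. GroundStatePair ⇐
Dirichlet half → torus half → pair.

KILL CRITERIA. A proof that the one-particle oscillation of Ψ₀/(Φ₀·s) grows with N for some
admissible v at arbitrarily small ρ (e.g. a log L from
an unscreened a/r tail, or an explicit 1-D/Bethe-ansatz or N = 2,3 witness showing L-dependence
beyond the profile) refutes WallDressing:
close `refuted:WallDressing` (the line is dead; hand the witness to
bc-transfer-influence-factorisation). ¬TorusLandscapeDirichletTypical
by a torus-side witness forces a pivot to the sup-form/coarse-density split or to consuming the
Palm-tilt transfer of card
bc-transfer-influence-factorisation; ¬GroundStatePair for pathological v (hard shells) forces a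
restatement over the physically
meant class and a separate item for those v. ¬PeriodicBEC (route BECPeriodicReduction) kills this
route with all torus-fed routes.
BoundaryTransferWeak (stmt-0827) proved by other means moots the route's purpose (WallDressing stays
of independent interest).

NOT DECOMPOSED YET. The constants C(ε,η), c(ε,η) and the choice ℓ ≍ healing length (8πρa)^(−1/2);
measurability of the bad sets; the Fubini /
MeasurableEquiv.piFinSuccAbove plumbing; the Hardy inequality and the lattice permanent trial state
(inside WallLayerMass); hard-core
connectivity and elliptic regularity (inside GroundStatePair); the coarse-density class and its
large-deviation bound (layer-2 child of
the torus crux); corner/edge behaviour of Ψ₀ (absorbed in the product profile s).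

CHEAPEST FALSIFIER. Free gas v ≡ 0 (admissible!): done by hand — Ψ₀ = ∏ sin(πx_k/L), Φ₀ = const;
with a FIXED ℓ the oscillation is ~ L/(πℓ) → ∞, which is
why the typed crux lets ℓ ≤ εL float per N; with ℓ = εL the ratio per coordinate lies in [sin(πε),
1], so WallDressing holds with
C = sin(πε)⁻³, and TLDT/InnerCondensation hold with the (8/π²)³-type constants. Next cheapest (not
run here): the 1-D Lieb–Liniger gas in a
hard-wall box (Gaudin 1971 doi:10.1103/PhysRevA.4.386; Batchelor–Guan–Oelkers–Lee 2005
doi:10.1088/0305-4470/38/36/001) where Ψ_D and Ψ_P are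
explicit Bethe states: compute osc_x log Ψ_D/(Ψ_P·s) as N grows (WallDressing is dimension-blind);
then N = 2,3 grid numerics of Ψ_D/Ψ_P in 3-D.

NUMBERS. Healing length ξ = (8πρa)^(−1/2) (GP); free-gas constant-mode fraction in the Dirichlet box
(8/π²)³ ≈ 0.533 (refuter notes on
stmt-0733); free-gas WallDressing constant C = sin(πε)⁻³; LandscapeTransfer output c = c₀c₁/(8C⁴)
with budgets η = 1/8 (three bad sets)
and layer mass 1/8; WallLayerMass needs 8b²(C_lat ρ^(2/3) + δ) ≤ 1/8. Items at open: 8 (1 target, 3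
cruxes, 3 support, 1 assembly).

DEFINITION REQUESTS. None filed: the ground-state interfaces are inlined in each statement
(Continuous, vanishing/periodic, ≥ 0, L²-limit up to phase of all
δ-near-minimisers). If several routes adopt them, `DirichletGroundState` / `TorusGroundState`
predicates in
Literature/MathematicalPhysics/QuantumManyBody would shorten every signature (to be requested by a
tenure pass, not now).

Novelty: Searches (2026-08-15): `lit search --hybrid "boundary Harnack principle ratio of positive ground
states Dirichlet versus periodic … Bose gas"`
(12 hits, textbooks only: LSSY2005 pp. 8,15,36,55); `lit vsearch "<Dirichlet GS = periodic GS ×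
product of boundary-layer profiles>"` (10 textbook hits,
nothing closer); `lit search --source zbmath` ×3 ("Bose gas Dirichlet boundary condensate boundary
layer" 0; "boundary Harnack principle uniform
dimension …" 0; "boundary Harnack infinite dimensional" 15, only Wang2012 relevant); `lit search
--source crossref "surface energy dilute Bose gas hard
wall boundary layer condensate wave function"` (12; Margetis2000 = one-body GP boundary layer);
OpenAlex and arXiv HTTP 429 this session; `lit galaxy
search "boundary conditions Bose-Einstein condensation interacting thermodynamic limit Dirichlet"
--star all` queued > 90 s (saturated); `lit frontier
AtomisticToContinuum --since 2022` (BEC descendants: arXiv:2603.20776 Junge2026, arXiv:2510.20493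
ChongLiangNam2026, arXiv:2602.16566); plus the card's
and audit-15's recorded searches (zbMATH 'Bose gas wall surface' → Gaudin 1971 / Batchelor et al.
2005; crossref GP-regime Bogoliubov papers).
Nearest prior art found: LiebSeiringer2002 / LiebSeiringerSolovejYngvason2005 Ch. 7 (GP limit: the
Dirichlet/trapped ground state condenses INTO the
GP minimiser — wall dressing is the whole story there, at ρa³ ~ N⁻²); Junge2026 Thm 3 (Neumann
localisation inequality, the nearest structural
boundary-condition  [refs: 2603.20776, 2510.20493, 2602.16566, LSSY2005, Wang2012, Margetis2000, Junge2026, ChongLiangNam2026, LiebSeiringer2002, LiebSeiringerSolovejYngvason2005, DaviesSimon1984, BassBurdzy1991]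

Barriers (technique_class: boundary-layer-factorisation principal-eigenfunction-ratio): - technique_class: boundary-layer-factorisation principal-eigenfunction-ratio
- Literature.Barriers.AtomisticToContinuum.KineticGapLengthScales: evaded — no kinetic gap and no
energy localisation anywhere; the comparison is multiplicative and pointwise in one variable,
energies enter only through the crude a-priori bound E₀ ≤ C·N·ρ^(2/3) in WallLayerMass; honest
residue: if the Harnack constant of WallDressing secretly pays the L² Poincaré constant of the
ground-state diffusion, the crux fails — that is its why-might-fail, not a use of the blocked
technique.
- Literature.Barriers.AtomisticToContinuum.EnergyAsymptoticsWithoutCondensation: evaded — nothing is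
inferred from energy asymptotics (1-D Lieb–Liniger witness respected: the torus crux is false in d =
1 and the route creates no condensation, it transports it).
- Literature.Barriers.AtomisticToContinuum.BogoliubovPerturbationInfrared: not engaged — no
expansion around a Bogoliubov state; used only as a guide (the wall is a density-channel,
gauge-invariant perturbation, the IR-benign class).
- Literature.Barriers.AtomisticToContinuum.CasimirBoxGeneralizedCondensation: confined to isotropic
cubes L = (N/ρ)^(1/3); the conclusion is macroscopic occupation of ONE explicit mode (type I), and
the transfer is a structural lemma rather than an assumption — exactly what the Casimir-box
phenomenon demands.
- Literature.Barriers.AtomisticToContinuum.PitaevskiiStringariOneDimension: respected — d = 3 enters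
through TorusLandscapeDiric

History (route lifecycle, newest last):
- 2026-08-15T13:41:06Z · CLOSED retired — not-a-thesis: assembly does not conclude the sub-problem Statement (operator:999:1257524)

sub-problem: BoseEinsteinCondensation · status: closed(retired) · opened planner-plancard-AtomisticToContinuum-BoseEin-f0f8cf77-0 2026-08-15T11:40:07Z · rev 0 · ledger route-AtomisticToContinuum-BECWallDressing
GENERATED by the gate from the ledger (D-0016/17). Provers cite these decls: `theorem foo : Summit.AtomisticToContinuum.BoseEinsteinCondensation.Theses.BECWallDressing.<Decl> := …` in Summits/AtomisticToContinuum/BoseEinsteinCondensation/Theorems/<Name>.lean.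
-/

namespace Summit.AtomisticToContinuum.BoseEinsteinCondensation.Theses.BECWallDressing

open scoped BigOperators Topology Manifold Classical MeasureTheory ProbabilityTheory Matrix InnerProductSpace ComplexConjugate ContinuousMap
open Filter Set Function TopologicalSpace MeasureTheory

attribute [summit_statement] _root_.BoseEinsteinCondensation

/-- item stmt-AtomisticToContinuum-5133 · target · rank 0 · closed · moot by None · by planner
why it might fail: it is Dirichlet-box BEC itself in landscape-free form; fails only if the conjunct fails or the ground state is degenerate (interface empty ⇒ vacuous, then TargetToBEC has nothing to feed).
sources: LiebSeiringerSolovejYngvason2005, Junge2026, ChongLiangNam2026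
[target] for every repulsive finite-range v, small ρ, some c > 0 and ε ∈ (0,1/4), for all large N
and every Dirichlet ground state Ψ₀ of N+1 bosons in the box of side L = sideLength ρ (N+1) (inlined
interface), the flat normalised mode of the inner cube Λ'_ε = (εL, L−εL)³ has occupation ≥ c(N+1) in
Ψ₀. -/
@[route_item "route-AtomisticToContinuum-BECWallDressing"]
def InnerCondensation : Prop :=
  ∀ v : ℝ → ENNReal, Literature.MathematicalPhysics.QuantumManyBody.BoseGas.IsRepulsiveFiniteRange v → ∃ ρ₀ : ℝ, 0 < ρ₀ ∧ ∀ ρ : ℝ, 0 < ρ → ρ < ρ₀ → ∃ c : ℝ, 0 < c ∧ ∃ ε : ℝ, 0 < ε ∧ ε < 1 / 4 ∧ ∀ᶠ N : ℕ in Filter.atTop, let L : ℝ := Literature.MathematicalPhysics.QuantumManyBody.BoseGas.sideLength ρ (N + 1); ∀ Ψ₀ : Literature.MathematicalPhysics.QuantumManyBody.BoseGas.Config (N + 1) → ℝ, (Continuous Ψ₀ ∧ (∀ X, X ∉ Literature.MathematicalPhysics.QuantumManyBody.BoseGas.boxN (N + 1) L → Ψ₀ X = 0) ∧ (∀ X,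 0 ≤ Ψ₀ X) ∧ ∀ η : ℝ, 0 < η → ∃ δ : ENNReal, 0 < δ ∧ ∀ Ψ : Literature.MathematicalPhysics.QuantumManyBody.BoseGas.TrialState (N + 1) L, Literature.MathematicalPhysics.QuantumManyBody.BoseGas.energy v Ψ ≤ Literature.MathematicalPhysics.QuantumManyBody.BoseGas.groundStateEnergy v (N + 1) L + δ → ∃ θ : ℝ, ∫⁻ X, (‖Ψ.ψ X - Complex.exp (↑θ * Complex.I) * (Ψ₀ X : ℂ)‖₊ : ENNReal) ^ 2 ≤ ENNReal.ofReal η) → ENNReal.ofReal (c * (N + 1)) ≤ Literature.MathematicalPhysics.QuantumManyBody.BoseGas.occupation (N + 1) ({z : EuclideanSpace ℝ (Fin 3) | ∀ j, z j ∈ Set.Ioo (ε * L) (L - ε * L)}.indicator fun _ => ((Real.sqrt (((1 - 2 * ε) * L) ^ 3))⁻¹ : ℂ)) (fun X => (Ψ₀ X : ℂ))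

/-- item stmt-AtomisticToContinuum-5134 · crux · rank 2 · closed · moot by None · by planner
why it might fail: Φ=Ψ_D/Ψ_P is harmonic for the FULL 3(N+1)-dim ground-state diffusion, not in x alone: Harnack/IU constants grow with dimension (DaviesSimon1984) unless curvature is available (Wang2012); an L²-Poincaré loss or an unscreened phonon tail would give osc ~ log L or worse.
sources: DaviesSimon1984, BassBurdzy1991, Pinsky1995, Wang2012, LiebSeiringer2002, LiebSeiringerSolovejYngvason2005
[crux] (card W1, boundary-Harnack form) for every repulsive finite-range v there is b > 0 (≥ its
range) such that at all small ρ, for every ε > 0 and η > 0 there is C with: for all large N there is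
ℓ ∈ (0, εL] such that for the Dirichlet ground state Ψ₀ and the torus ground state Φ₀ of N+1 bosons
(side L = sideLength ρ (N+1), inlined interfaces) the set of environments Y for which
C·Ψ₀(y::Y)Φ₀(x::Y)s(x) < Ψ₀(x::Y)Φ₀(y::Y)s(y) for some x, y ∈ Λ_b (i.e. the one-particle oscillation
of Ψ₀/(Φ₀·s) over Λ_b exceeds C; s(z) = ∏_k min(1, z_k/ℓ, (L−z_k)/ℓ)) has w_D-mass ≤ η. Free gas:
holds with ℓ = εL, C = sin(πε)⁻³ (Ψ₀ = ∏ sin, Φ₀ = const). [difficulty: XL] -/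
@[route_item "route-AtomisticToContinuum-BECWallDressing"]
def WallDressing : Prop :=
  ∀ v : ℝ → ENNReal, Literature.MathematicalPhysics.QuantumManyBody.BoseGas.IsRepulsiveFiniteRange v → ∃ b : ℝ, 0 < b ∧ ∃ ρ₀ : ℝ, 0 < ρ₀ ∧ ∀ ρ : ℝ, 0 < ρ → ρ < ρ₀ → ∀ ε : ℝ, 0 < ε → ∀ η : ℝ, 0 < η → ∃ C : ℝ, 0 < C ∧ ∀ᶠ N : ℕ in Filter.atTop, let L : ℝ := Literature.MathematicalPhysics.QuantumManyBody.BoseGas.sideLength ρ (N + 1); ∃ ℓ : ℝ, 0 < ℓ ∧ ℓ ≤ ε * L ∧ (let Λb : Set Literature.MathematicalPhysics.QuantumManyBody.BoseGas.Space := {z : Literature.MathematicalPhysics.QuantumManyBody.BoseGas.Space | ∀ k, z k ∈ Set.Ioo b (L - b)}; let s : Literature.MathematicalPhysics.QuantumManyBody.BoseGas.Space → ℝ := fun z => ∏ k : Fin 3, min 1 (min (z k / ℓ) ((L - z k) / ℓ)); ∀ Ψ₀ Φ₀ : Literature.MathematicalPhysics.QuantumManyBody.BoseGas.Config (N + 1)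 → ℝ, (Continuous Ψ₀ ∧ (∀ X, X ∉ Literature.MathematicalPhysics.QuantumManyBody.BoseGas.boxN (N + 1) L → Ψ₀ X = 0) ∧ (∀ X, 0 ≤ Ψ₀ X) ∧ ∀ η : ℝ, 0 < η → ∃ δ : ENNReal, 0 < δ ∧ ∀ Ψ : Literature.MathematicalPhysics.QuantumManyBody.BoseGas.TrialState (N + 1) L, Literature.MathematicalPhysics.QuantumManyBody.BoseGas.energy v Ψ ≤ Literature.MathematicalPhysics.QuantumManyBody.BoseGas.groundStateEnergy v (N + 1) L + δ → ∃ θ : ℝ, ∫⁻ X, (‖Ψ.ψ X - Complex.exp (↑θ * Complex.I) * (Ψ₀ X : ℂ)‖₊ : ENNReal) ^ 2 ≤ ENNReal.ofReal η) → (Continuous Φ₀ ∧ (∀ (X : Literature.MathematicalPhysics.QuantumManyBody.BoseGas.Config (N + 1)) (i : Fin (N + 1)) (k : Fin 3), Φ₀ (X + Pi.single i (EuclideanSpace.single k L)) = Φ₀ X) ∧ (∀ X, 0 ≤ Φ₀ X) ∧ ∀ η : ℝ, 0 < η → ∃ δ : ENNReal, 0 < δ ∧ ∀ Φ : Literature.MathematicalPhysics.QuantumManyBody.BoseGas.PeriodicTrialState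 (N + 1) L, Literature.MathematicalPhysics.QuantumManyBody.BoseGas.periodicEnergy v Φ ≤ Literature.MathematicalPhysics.QuantumManyBody.BoseGas.periodicGroundStateEnergy v (N + 1) L + δ → ∃ θ : ℝ, ∫⁻ X in Literature.MathematicalPhysics.QuantumManyBody.BoseGas.cellN (N + 1) L, (‖Φ.ψ X - Complex.exp (↑θ * Complex.I) * (Φ₀ X : ℂ)‖₊ : ENNReal) ^ 2 ≤ ENNReal.ofReal η) → ∫⁻ Y : Literature.MathematicalPhysics.QuantumManyBody.BoseGas.Config N, Set.indicator {Y : Literature.MathematicalPhysics.QuantumManyBody.BoseGas.Config N | ∃ x ∈ Λb, ∃ y ∈ Λb, C * (Ψ₀ (Matrix.vecCons y Y) * Φ₀ (Matrix.vecCons x Y) * s x) < Ψ₀ (Matrix.vecCons x Y) * Φ₀ (Matrix.vecCons y Y) * s y} (fun _ => (1 : ENNReal)) Y * (∫⁻ x : Literature.MathematicalPhysics.QuantumManyBody.BoseGas.Space, ENNReal.ofReal (Ψ₀ (Matrix.vecCons x Y) ^ 2)) ≤ ENNReal.ofReal η)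

/-- item stmt-AtomisticToContinuum-5135 · crux · rank 3 · closed · moot by None · by planner
why it might fail: Dirichlet-typical Y (depleted wall layer, N^(2/3) displaced bosons) are torus-atypical at large-deviation scale; torus engines give π_P-averages (0826) only; needs self-averaging of cos²∠(1,Φ₀(·::Y)) plus stability under wall conditioning. False in d=1.
sources: LiebSeiringerSolovejYngvason2005, Fournais2020, Junge2026, ChongLiangNam2026, Literature.Barriers.AtomisticToContinuum.PitaevskiiStringariOneDimension
[crux] (card W2 + PL jointly, typical-set form) for every repulsive finite-range v, small ρ, every ε
∈ [0,1/4) and η > 0 there is c > 0 with: for all large N, for the Dirichlet/torus ground-state pair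
(Ψ₀, Φ₀) of N+1 bosons, the set of environments Y whose TORUS conditional amplitude x ↦ Φ₀(x::Y)
fails (∫_Λ'ε Φ₀)² ≥ c·|Λ'ε|·∫_Λ'ε Φ₀² on the inner cube Λ'_ε of the box has w_D-mass ≤ η —
delocalisation of the torus landscape, but measured under the DIRICHLET law of the environment.
[difficulty: XL] -/
@[route_item "route-AtomisticToContinuum-BECWallDressing"]
def TorusLandscapeDirichletTypical : Prop :=
  ∀ v : ℝ → ENNReal, Literature.MathematicalPhysics.QuantumManyBody.BoseGas.IsRepulsiveFiniteRange v → ∃ ρ₀ : ℝ, 0 < ρ₀ ∧ ∀ ρ : ℝ, 0 < ρ → ρ < ρ₀ → ∀ ε : ℝ, 0 ≤ ε → ε < 1 / 4 → ∀ η : ℝ, 0 < η → ∃ c : ℝ, 0 < c ∧ ∀ᶠ N : ℕ in Filter.atTop, let L : ℝ := Literature.MathematicalPhysics.QuantumManyBody.BoseGas.sideLength ρ (N + 1); let Λ' : Set Literature.MathematicalPhysics.QuantumManyBody.BoseGas.Space := {z : Literature.MathematicalPhysics.QuantumManyBody.BoseGas.Space | ∀ j, z j ∈ Set.Ioo (ε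 * L) (L - ε * L)}; ∀ Ψ₀ Φ₀ : Literature.MathematicalPhysics.QuantumManyBody.BoseGas.Config (N + 1) → ℝ, (Continuous Ψ₀ ∧ (∀ X, X ∉ Literature.MathematicalPhysics.QuantumManyBody.BoseGas.boxN (N + 1) L → Ψ₀ X = 0) ∧ (∀ X, 0 ≤ Ψ₀ X) ∧ ∀ η : ℝ, 0 < η → ∃ δ : ENNReal, 0 < δ ∧ ∀ Ψ : Literature.MathematicalPhysics.QuantumManyBody.BoseGas.TrialState (N + 1) L, Literature.MathematicalPhysics.QuantumManyBody.BoseGas.energy v Ψ ≤ Literature.MathematicalPhysics.QuantumManyBody.BoseGas.groundStateEnergy v (N + 1) L + δ → ∃ θ : ℝ, ∫⁻ X, (‖Ψ.ψ X - Complex.exp (↑θ * Complex.I) * (Ψ₀ X : ℂ)‖₊ : ENNReal) ^ 2 ≤ ENNReal.ofReal η) → (Continuous Φ₀ ∧ (∀ (X : Literature.MathematicalPhysics.QuantumManyBody.BoseGas.Config (N + 1)) (i : Fin (N + 1)) (k : Fin 3), Φ₀ (X + Pi.single i (EuclideanSpace.single k L)) = Φ₀ X) ∧ (∀ X, 0 ≤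 Φ₀ X) ∧ ∀ η : ℝ, 0 < η → ∃ δ : ENNReal, 0 < δ ∧ ∀ Φ : Literature.MathematicalPhysics.QuantumManyBody.BoseGas.PeriodicTrialState (N + 1) L, Literature.MathematicalPhysics.QuantumManyBody.BoseGas.periodicEnergy v Φ ≤ Literature.MathematicalPhysics.QuantumManyBody.BoseGas.periodicGroundStateEnergy v (N + 1) L + δ → ∃ θ : ℝ, ∫⁻ X in Literature.MathematicalPhysics.QuantumManyBody.BoseGas.cellN (N + 1) L, (‖Φ.ψ X - Complex.exp (↑θ * Complex.I) * (Φ₀ X : ℂ)‖₊ : ENNReal) ^ 2 ≤ ENNReal.ofReal η) → ∫⁻ Y : Literature.MathematicalPhysics.QuantumManyBody.BoseGas.Config N, Set.indicator {Y : Literature.MathematicalPhysics.QuantumManyBody.BoseGas.Config N | (∫⁻ x in Λ', ENNReal.ofReal (Φ₀ (Matrix.vecCons x Y))) ^ 2 < ENNReal.ofReal c * MeasureTheory.volume Λ' * ∫⁻ x in Λ', ENNReal.ofReal (Φ₀ (Matrix.vecCons x Y) ^ 2)} (fun _ => (1 : ENNReal)) Y * (∫⁻ x : Literature.MathematicalPhysics.QuantumManyBody.BoseGas.Space,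 ENNReal.ofReal (Ψ₀ (Matrix.vecCons x Y) ^ 2)) ≤ ENNReal.ofReal η

/-- item stmt-AtomisticToContinuum-5136 · crux · rank 4 · closed · moot by None · by planner
why it might fail: IsRepulsiveFiniteRange admits hard shells (v = ⊤ on an annulus) and non-Kato finite singularities: configuration space may disconnect (hard-core connectivity in a box is itself open at moderate density) ⇒ degenerate ground space ⇒ no common L²-limit.
sources: LiebSeiringerSolovejYngvason2005, DaviesSimon1984, Pinsky1995
[crux] for every repulsive finite-range v, all small ρ and all large N, both inlined interfaces are
inhabited at side L = sideLength ρ (N+1): there is a continuous Ψ₀ ≥ 0 vanishing off the box such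
that for every η > 0 some δ > 0 makes every δ-near-minimiser of the Dirichlet energy L²-within η of
e^(iθ)Ψ₀ for some θ, and a continuous periodic Φ₀ ≥ 0 with the same property for the torus energy on
the cell (existence + uniqueness up to phase + positivity + continuity of the two ground states;
compact resolvent, Perron–Frobenius / positivity-improving semigroup, elliptic regularity; E₀ < ⊤
via a lattice permanent trial state at ρ < c·range⁻³). [difficulty: L] -/
@[route_item "route-AtomisticToContinuum-BECWallDressing"]
def GroundStatePair : Prop :=
  ∀ v : ℝ → ENNReal, Literature.MathematicalPhysics.QuantumManyBody.BoseGas.IsRepulsiveFiniteRange v → ∃ ρ₀ : ℝ, 0 < ρ₀ ∧ ∀ ρ : ℝ, 0 < ρ → ρ < ρ₀ → ∀ᶠ N : ℕ in Filter.atTop, let L : ℝ := Literature.MathematicalPhysics.QuantumManyBody.BoseGas.sideLength ρ (N + 1); (∃ Ψ₀ : Literature.MathematicalPhysics.QuantumManyBody.BoseGas.Config (N + 1) → ℝ, (Continuous Ψ₀ ∧ (∀ X, X ∉ Literature.MathematicalPhysics.QuantumManyBody.BoseGas.boxN (N + 1) L → Ψ₀ X = 0) ∧ (∀ X, 0 ≤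 Ψ₀ X) ∧ ∀ η : ℝ, 0 < η → ∃ δ : ENNReal, 0 < δ ∧ ∀ Ψ : Literature.MathematicalPhysics.QuantumManyBody.BoseGas.TrialState (N + 1) L, Literature.MathematicalPhysics.QuantumManyBody.BoseGas.energy v Ψ ≤ Literature.MathematicalPhysics.QuantumManyBody.BoseGas.groundStateEnergy v (N + 1) L + δ → ∃ θ : ℝ, ∫⁻ X, (‖Ψ.ψ X - Complex.exp (↑θ * Complex.I) * (Ψ₀ X : ℂ)‖₊ : ENNReal) ^ 2 ≤ ENNReal.ofReal η)) ∧ (∃ Φ₀ : Literature.MathematicalPhysics.QuantumManyBody.BoseGas.Config (N + 1) → ℝ, (Continuous Φ₀ ∧ (∀ (X : Literature.MathematicalPhysics.QuantumManyBody.BoseGas.Config (N + 1)) (i : Fin (N + 1)) (k : Fin 3), Φ₀ (X + Pi.single i (EuclideanSpace.single k L)) = Φ₀ X) ∧ (∀ X, 0 ≤ Φ₀ X) ∧ ∀ η : ℝ, 0 < η → ∃ δ : ENNReal, 0 < δ ∧ ∀ Φ : Literature.MathematicalPhysics.QuantumManyBody.BoseGas.PeriodicTrialState (N + 1) L, Literature.MathematicalPhysics.QuantumManyBody.BoseGas.periodicEnergy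 v Φ ≤ Literature.MathematicalPhysics.QuantumManyBody.BoseGas.periodicGroundStateEnergy v (N + 1) L + δ → ∃ θ : ℝ, ∫⁻ X in Literature.MathematicalPhysics.QuantumManyBody.BoseGas.cellN (N + 1) L, (‖Φ.ψ X - Complex.exp (↑θ * Complex.I) * (Φ₀ X : ℂ)‖₊ : ENNReal) ^ 2 ≤ ENNReal.ofReal η))

/-- item stmt-AtomisticToContinuum-5137 · support · rank 9 · closed · moot by None · by planner
sources: LiebSeiringerSolovejYngvason2005
[support] for every repulsive finite-range v and every b > 0, at all small ρ (depending on b) and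
all large N, the Dirichlet ground state Ψ₀ (interface) gives probability ≤ 1/8 to particle 0 lying
within b of a face. Proof sketch: 1-D Hardy ∫u'² ≥ ¼∫u²/t² per face ⇒ P(layer) ≤ 8b²·(kinetic energy
per particle) for C¹ near-minimisers; E₀(N+1, L) ≤ C(N+1)ρ^(2/3) by the symmetrised product of
disjoint bumps on a lattice of spacing ~ρ^(−1/3) > 4·range (no interaction); pass to the L²-limit
Ψ₀. [difficulty: provable-now] -/
@[route_item "route-AtomisticToContinuum-BECWallDressing"]
def WallLayerMass : Prop :=
  ∀ v : ℝ → ENNReal, Literature.MathematicalPhysics.QuantumManyBody.BoseGas.IsRepulsiveFiniteRange v → ∀ b : ℝ, 0 < b → ∃ ρ₀ : ℝ, 0 < ρ₀ ∧ ∀ ρ : ℝ, 0 < ρ → ρ < ρ₀ → ∀ᶠ N : ℕ in Filter.atTop, let L : ℝ := Literature.MathematicalPhysics.QuantumManyBody.BoseGas.sideLength ρ (N + 1); ∀ Ψ₀ : Literature.MathematicalPhysics.QuantumManyBody.BoseGas.Config (N + 1) → ℝ, (Continuous Ψ₀ ∧ (∀ X, X ∉ Literature.MathematicalPhysics.QuantumManyBody.BoseGas.boxN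 (N + 1) L → Ψ₀ X = 0) ∧ (∀ X, 0 ≤ Ψ₀ X) ∧ ∀ η : ℝ, 0 < η → ∃ δ : ENNReal, 0 < δ ∧ ∀ Ψ : Literature.MathematicalPhysics.QuantumManyBody.BoseGas.TrialState (N + 1) L, Literature.MathematicalPhysics.QuantumManyBody.BoseGas.energy v Ψ ≤ Literature.MathematicalPhysics.QuantumManyBody.BoseGas.groundStateEnergy v (N + 1) L + δ → ∃ θ : ℝ, ∫⁻ X, (‖Ψ.ψ X - Complex.exp (↑θ * Complex.I) * (Ψ₀ X : ℂ)‖₊ : ENNReal) ^ 2 ≤ ENNReal.ofReal η) → ∫⁻ X : Literature.MathematicalPhysics.QuantumManyBody.BoseGas.Config (N + 1), Set.indicator {X : Literature.MathematicalPhysics.QuantumManyBody.BoseGas.Config (N + 1) | ∃ k, X 0 k ≤ b ∨ L - b ≤ X 0 k} (fun _ => (1 : ENNReal)) X * ENNReal.ofReal (Ψ₀ X ^ 2) ≤ ENNReal.ofReal (1 / 8)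

/-- item stmt-AtomisticToContinuum-5138 · support · rank 9 · closed · moot by None · by planner
sources: LiebSeiringerSolovejYngvason2005
[support] WallDressing → TorusLandscapeDirichletTypical → WallLayerMass → GroundStatePair →
InnerCondensation. Angle algebra at η = 1/8: c₀ = c(ε=0), choose ε₁ < c₀/24, C = C(ε₁), c₁ = c(ε₁);
for Good Y (outside the three bad sets) on Λ_b one has Ψ₀ = r·s·Φ₀ with sup r ≤ C inf r, whence
(∫_Λ'ψ)² ≥ (c₁/C²)|Λ'|∫_Λ'ψ² and ∫_Λ'ψ² ≥ (c₀/4C²)∫_Λb ψ²; integrating in Y with Fubini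
(piFinSuccAbove) and the layer bound: occupation/(N+1) ≥ (c₀c₁/4C⁴)(1 − 1/8 − 3/8) = c₀c₁/(8C⁴); the
torus ground state enters only to instantiate the two cruxes (GroundStatePair). [difficulty: M] -/
@[route_item "route-AtomisticToContinuum-BECWallDressing"]
def LandscapeTransfer : Prop :=
  WallDressing → TorusLandscapeDirichletTypical → WallLayerMass → GroundStatePair → InnerCondensation

/-- item stmt-AtomisticToContinuum-5139 · support · rank 9 · closed · moot by None · by planner
sources: LiebSeiringerSolovejYngvason2005
[support] InnerCondensation → GroundStatePair → BoseEinsteinCondensation. The inner flat mode is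
measurable and L²-normalised (pattern of Theorems/BECInfraredBoundAssembly: lintegral_constMode_sq,
bec_of_zeroMode); occupation^(1/2)/√(N+1) is a 1-Lipschitz seminorm in L² and phase-blind, so the
interface's near-minimiser clause with η ≤ c/4 gives occupation ≥ (c/4)(N+1) for every
δ-near-minimiser; le_condensateNumber and occupation_le_maxOccupation give HasGroundStateBEC v ρ
with constant c/4 (index shift N ↦ N+1 under ∀ᶠ). [difficulty: provable-now] -/
@[route_item "route-AtomisticToContinuum-BECWallDressing"]
def TargetToBEC : Prop :=
  InnerCondensation → GroundStatePair → Literature.MathematicalPhysics.QuantumManyBody.BoseGas.BoseEinsteinCondensation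

/-- item stmt-AtomisticToContinuum-5140 · assembly · rank 1 · closed · moot by None · by planner
sources: LiebSeiringerSolovejYngvason2005
[assembly] WallDressing → TorusLandscapeDirichletTypical → GroundStatePair → WallLayerMass →
BoseEinsteinCondensation. -/
@[route_item "route-AtomisticToContinuum-BECWallDressing"]
def Assembly : Prop :=
  WallDressing → TorusLandscapeDirichletTypical → GroundStatePair → WallLayerMass → Literature.MathematicalPhysics.QuantumManyBody.BoseGas.BoseEinsteinCondensation

end Summit.AtomisticToContinuum.BoseEinsteinCondensation.Theses.BECWallDressing
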